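import Literature.Dynamics.IntervalMaps.TentLogisticConjugacy
import Literature.Dynamics.IntervalMaps.HorseshoeScrambledSet
import HarnessLib

/-!
# Chaos from a non-power-of-two period, and the standard examples: the tent map and the logistic map
# `F₄(x) = 4x(1 − x)` have positive entropy and are Li–Yorke chaotic (Ruette, *Chaos on the interval*, Theorems 4.58,
# 5.17; Li–Yorke 1975; Robinson §2.6 Example 6.2)

Foundations-library file (lane `lit-hodgefound`, prover p24 gen 81; one-dimensional dynamics series, file 17).
THEOREMS only; no definition, no named fact, net debt 0.

## Sources

S. Ruette, *Chaos on the interval* (held `paper:arxiv-1504.03001`) [Ruette2017ChaosInterval]: Theorem 4.58 («(ii) `f`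
has a periodic point whose period is not a power of `2`» ⇒ «(i) the topological entropy of `f` is positive») and
Theorem 5.17 («there exists a `δ`-scrambled […] set […] `f` is chaotic in the sense of Li-Yorke»).  T.-Y. Li,
J. A. Yorke [LiYorke1975], Theorem 1 (T2).  C. Robinson, *Dynamical Systems* [Robinson1999DynamicalSystems], §2.6
Example 6.2 (tent map `T`, quadratic family `F_μ`, conjugacy `H(y) = sin²(πy/2)`).

## What is formalized (all PROVED)

* §1 **`liYorke_T2_of_not_two_pow`** — Li–Yorke's T2 (uncountable `δ`-scrambled set without periodic points,
  clauses (A) and (B)) from any least period that is not a power of two (files `HorseshoeScrambledSet`,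
  `OddPeriodPositiveEntropy`).
* §2 the tent map `T(y) = 1 − |2y − 1|` on `[0, 1]`: least period `3` at `2/7`, `0 < h(T, [0,1])`
  (`ENNReal.log 2 ≤ 4·h`), and Li–Yorke's T2 (`liYorke_T2_tentMap`).
* §3 the logistic map `F₄` on `[0, 1]`: least period `3` at `sin²(π/7)`, `0 < h(F₄, [0,1])`, Li–Yorke's T2
  (`liYorke_T2_logisticMap_four`).

Tree search (FAIL-DUP, 2026-09-01): no chaos statement for the tent/logistic maps in Mathlib or `Literature/`.
-/

noncomputable section

open Set Function Filter Dynamics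

namespace Literature.Dynamics.IntervalMaps

variable {f : ℝ → ℝ} {A B : ℝ}

/-! ## §1 Li–Yorke's T2 from any least period that is not a power of two -/

/-- **Li–Yorke's T2 from a least period `m = 2^k p`, `p ≥ 3` odd** (apply the odd case to `f^{2^k}` and return to
`f` along the times `2^k n`; periodic points of `f` are periodic points of `f^{2^k}`).
[cite: LiYorke1975, Theorem 1 (T2)] [cite: Ruette2017ChaosInterval, Theorem 5.17 with Theorem 4.58 (ii)] -/
theorem liYorke_T2_of_not_two_pow (hf : ContinuousOn f (Icc A B)) (hmaps : MapsTo f (Icc A B) (Icc A B))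
    {x₀ : ℝ} (hx₀ : x₀ ∈ Icc A B) {m : ℕ} (hper : minimalPeriod f x₀ = m) (hm0 : m ≠ 0)
    (hm : ∀ j : ℕ, m ≠ 2 ^ j) :
    ∃ δ > 0, ∃ S : Set ℝ, S ⊆ Icc A B ∧ ¬ S.Countable ∧ (∀ x ∈ S, x ∉ periodicPts f) ∧
      (∀ x ∈ S, ∀ y ∈ S, x ≠ y →
        (∀ N, ∃ n, N ≤ n ∧ δ ≤ |f^[n] x - f^[n] y|) ∧ (∀ ε > 0, ∀ N, ∃ n, N ≤ n ∧ |f^[n] x - f^[n] y| < ε)) ∧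
      (∀ x ∈ S, ∀ q ∈ periodicPts f, ∀ N, ∃ n, N ≤ n ∧ δ ≤ |f^[n] x - f^[n] q|) := by
  obtain ⟨k, p, hp, rfl⟩ := Nat.exists_eq_two_pow_mul_odd hm0
  have hp3 : 3 ≤ p := by
    rcases hp with ⟨r, rfl⟩
    rcases Nat.eq_zero_or_pos r with rfl | hr
    · exact absurd (by simp) (hm k)
    · omega
  have hK : (0 : ℕ) < 2 ^ k := by positivity
  have hgc : ContinuousOn (f^[2 ^ k]) (Icc A B) := hf.iterate hmaps _
  have hgm : MapsTo (f^[2 ^ k]) (Icc A B) (Icc A B) := hmaps.iterate _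
  have hgper : minimalPeriod (f^[2 ^ k]) x₀ = p := minimalPeriod_iterate_two_pow_eq_of_odd hper hp le_rfl
  obtain ⟨δ, hδ, S, hS, hunc, hnoper, hA, hB⟩ := liYorke_T2_of_odd_period hgc hgm hx₀ hp3 hp hgper
  have hperf : ∀ q, q ∈ periodicPts f → q ∈ periodicPts (f^[2 ^ k]) := fun q hq => by
    obtain ⟨P, hP, hqP⟩ := mem_periodicPts.1 hq
    refine mem_periodicPts.2 ⟨P, hP, ?_⟩
    show (f^[2 ^ k])^[P] q = q
    rw [← iterate_mul]
    exact hqP.const_mul _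
  refine ⟨δ, hδ, S, hS, hunc, fun x hx hxper => hnoper x hx (hperf x hxper), ?_, ?_⟩
  · intro x hx y hy hne
    obtain ⟨hsep, hprox⟩ := hA x hx y hy hne
    exact liYorkePair_of_iterate hK hsep hprox
  · intro x hx q hq N
    obtain ⟨n, hn, h⟩ := hB x hx q (hperf q hq) N
    exact ⟨2 ^ k * n, hn.trans (Nat.le_mul_of_pos_left n hK), by rwa [iterate_mul]⟩

/-! ## §2 The tent map -/

/-- The tent map has least period `3` at `2/7` (`2/7 ↦ 4/7 ↦ 6/7 ↦ 2/7`).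
[cite: Robinson1999DynamicalSystems, §2.6 Example 6.2] [cite: Du2007SharkovskyCollection, §13 (the tent map `T`)] -/
theorem minimalPeriod_tentMap_two_sevenths : minimalPeriod tentMap (2 / 7) = 3 := by
  rw [← minimalPeriod_logisticMap_four_sinSqConj (by norm_num)]
  exact minimalPeriod_logisticMap_four_sinSqConj_two_sevenths

/-- **The tent map has positive topological entropy on `[0, 1]`**, indeed `log 2 ≤ 4·h(T, [0,1])`
(Bowen–Franks from the `3`-cycle). [cite: Ruette2017ChaosInterval, Theorem 4.58 (ii) ⇒ (i)] [cite: BowenFranks1976, Theorem] -/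
theorem log_two_le_mul_coverEntropy_tentMap : (ENNReal.log 2 : EReal) ≤ (4 : ℕ) * coverEntropy tentMap (Icc 0 1) :=
  log_two_le_mul_coverEntropy_of_odd continuous_tentMap.continuousOn mapsTo_tentMap
    (show (2 / 7 : ℝ) ∈ Icc 0 1 by constructor <;> norm_num) le_rfl ⟨1, rfl⟩ minimalPeriod_tentMap_two_sevenths

/-- `0 < h(T, [0, 1])`. [cite: Ruette2017ChaosInterval, Theorem 4.58 (ii) ⇒ (i)] -/
theorem coverEntropy_tentMap_pos : 0 < coverEntropy tentMap (Icc (0 : ℝ) 1) :=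
  coverEntropy_pos_of_odd continuous_tentMap.continuousOn mapsTo_tentMap
    (show (2 / 7 : ℝ) ∈ Icc 0 1 by constructor <;> norm_num) le_rfl ⟨1, rfl⟩ minimalPeriod_tentMap_two_sevenths

/-- **The tent map is chaotic in the sense of Li–Yorke on `[0, 1]`** (Li–Yorke's T2 from its `3`-cycle).
[cite: LiYorke1975, Theorem 1 (T2)] [cite: Ruette2017ChaosInterval, Theorem 5.17] -/
theorem liYorke_T2_tentMap :
    ∃ δ > 0, ∃ S : Set ℝ, S ⊆ Icc 0 1 ∧ ¬ S.Countable ∧ (∀ x ∈ S, x ∉ periodicPts tentMap) ∧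
      (∀ x ∈ S, ∀ y ∈ S, x ≠ y →
        (∀ N, ∃ n, N ≤ n ∧ δ ≤ |tentMap^[n] x - tentMap^[n] y|) ∧
        (∀ ε > 0, ∀ N, ∃ n, N ≤ n ∧ |tentMap^[n] x - tentMap^[n] y| < ε)) ∧
      (∀ x ∈ S, ∀ q ∈ periodicPts tentMap, ∀ N, ∃ n, N ≤ n ∧ δ ≤ |tentMap^[n] x - tentMap^[n] q|) :=
  liYorke_T2_of_period_three continuous_tentMap.continuousOn mapsTo_tentMap
    (show (2 / 7 : ℝ) ∈ Icc 0 1 by constructor <;> norm_num) minimalPeriod_tentMap_two_sevenths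

/-! ## §3 The logistic map `F₄(x) = 4x(1 − x)` -/

/-- **The logistic map `F₄` has positive topological entropy on `[0, 1]`**, indeed `log 2 ≤ 4·h(F₄, [0,1])`
(Bowen–Franks from the `3`-cycle `sin²(π/7) ↦ sin²(2π/7) ↦ sin²(3π/7)`).
[cite: Ruette2017ChaosInterval, Theorem 4.58 (ii) ⇒ (i)] [cite: BowenFranks1976, Theorem]
[cite: Robinson1999DynamicalSystems, §2.6 Example 6.2] -/
theorem log_two_le_mul_coverEntropy_logisticMap_four :
    (ENNReal.log 2 : EReal) ≤ (4 : ℕ) * coverEntropy (logisticMap 4) (Icc 0 1) :=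
  log_two_le_mul_coverEntropy_of_odd (continuous_logisticMap 4).continuousOn mapsTo_logisticMap_four
    (sinSqConj_mem _) le_rfl ⟨1, rfl⟩ minimalPeriod_logisticMap_four_sinSqConj_two_sevenths

/-- `0 < h(F₄, [0, 1])`. [cite: Ruette2017ChaosInterval, Theorem 4.58 (ii) ⇒ (i)] -/
theorem coverEntropy_logisticMap_four_pos : 0 < coverEntropy (logisticMap 4) (Icc (0 : ℝ) 1) :=
  coverEntropy_pos_of_odd (continuous_logisticMap 4).continuousOn mapsTo_logisticMap_four (sinSqConj_mem _)
    le_rfl ⟨1, rfl⟩ minimalPeriod_logisticMap_four_sinSqConj_two_sevenths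

/-- **The logistic map `F₄(x) = 4x(1 − x)` is chaotic in the sense of Li–Yorke on `[0, 1]`** (Li–Yorke's T2 from its
`3`-cycle). [cite: LiYorke1975, Theorem 1 (T2)] [cite: Ruette2017ChaosInterval, Theorem 5.17]
[cite: Robinson1999DynamicalSystems, §2.6 Example 6.2] -/
theorem liYorke_T2_logisticMap_four :
    ∃ δ > 0, ∃ S : Set ℝ, S ⊆ Icc 0 1 ∧ ¬ S.Countable ∧ (∀ x ∈ S, x ∉ periodicPts (logisticMap 4)) ∧
      (∀ x ∈ S, ∀ y ∈ S, x ≠ y →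
        (∀ N, ∃ n, N ≤ n ∧ δ ≤ |(logisticMap 4)^[n] x - (logisticMap 4)^[n] y|) ∧
        (∀ ε > 0, ∀ N, ∃ n, N ≤ n ∧ |(logisticMap 4)^[n] x - (logisticMap 4)^[n] y| < ε)) ∧
      (∀ x ∈ S, ∀ q ∈ periodicPts (logisticMap 4), ∀ N, ∃ n, N ≤ n ∧
        δ ≤ |(logisticMap 4)^[n] x - (logisticMap 4)^[n] q|) :=
  liYorke_T2_of_period_three (continuous_logisticMap 4).continuousOn mapsTo_logisticMap_four (sinSqConj_mem _)
    minimalPeriod_logisticMap_four_sinSqConj_two_sevenths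

end Literature.Dynamics.IntervalMaps
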